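import Summits.CriticalPhenomena.PercolationContinuityZ3.Theorems.Transplant.SkelFrmFromBParamsRootLam
import Summits.CriticalPhenomena.PercolationContinuityZ3.Theorems.Transplant.SkelFrmBParamsRootLam
import Summits.CriticalPhenomena.PercolationContinuityZ3.Theorems.Transplant.SkelFrmFromBParamsSlotsF
import Summits.CriticalPhenomena.PercolationContinuityZ3.Theorems.Transplant.SkelFrmBParamsSlotsF
import Summits.CriticalPhenomena.PercolationContinuityZ3.Theorems.Transplant.SkelFrmFromBChoiceNums
import Summits.CriticalPhenomena.PercolationContinuityZ3.Theorems.Transplant.SkelFrmBChoiceNums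
import Summits.CriticalPhenomena.PercolationContinuityZ3.Theorems.Transplant.SkelFrmFromBParamsSchedA
import Summits.CriticalPhenomena.PercolationContinuityZ3.Theorems.Transplant.SkelFrmBParamsSchedA
import Summits.CriticalPhenomena.PercolationContinuityZ3.Theorems.Transplant.PlanarSkeletonFrmFromDefs
import Summits.CriticalPhenomena.PercolationContinuityZ3.Theorems.Transplant.PlanarSkeletonFrmDefs
import Summits.CriticalPhenomena.PercolationContinuityZ3.Theorems.Transplant.SkelPhiStepIDataNS
import HarnessLib
import Summits.CriticalPhenomena.PercolationContinuityZ3.Theorems.Transplant.SkelFrmBParamsFaceLamA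
/-!
# U-WAVE PORT (RULING D-U, lead g21 2026-08-26; WAVE-U-MANIFEST v3.1 row «SkelFrmBParamsFaceLamA» ↦ «SkelFrmFromBParamsFaceLamA») of the tree module
# `Transplant/SkelFrmBParamsFaceLamA` onto the carrier `PlanarSkeletonFrmFrom` (frames only, cylinders connected from width `ℓ₀` on)

ORIGINAL TITLE: (F) VALUE LAYER, N2 twin (hp-8 g42, 2026-08-23; F-DISCHARGE-MAP-N2 G9/(Δ3)): `port_frm.py` text of N1 `SkelNegBParamsFaceLamA` (stmt-g16) over the N2 wide pair

builds on p205010 (kernel theorem, internal audit signed; external expert review pending) — nothing in this file uses p205010; NOTHING is claimed about the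
OPEN node U `SamePDropOfSkeletonFrmFrom₁` (nor U_s / the end state).  Lane `prim-bschramm`, seat `prim-bschramm-stmt` gen 26 (port pen, RULING M-11 family P-stmt; tool = p3-g26's port_u.py of record, registry-driven inputs); helper file
(`--supports stmt-CriticalPhenomena-4575 --as helper`).  PORT RULES r1–r4 of RULING D-U: declaration order and proof texts are those of the original,
byte-identical except (i) the carrier token `PlanarSkeletonFrm ↦ PlanarSkeletonFrmFrom` (binders, `namespace`/`end` lines, qualified names of twinned
declarations), (ii) carrier-FREE declarations of the original (φ-level `Skelφ…` blocks and namespace-only arithmetic residents) are NOT re-declared —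
this file imports the original and `export`s the twin-free residents (POLICY T / treatment (m1)); residents whose statement mentions a twinned
constant are copied, (iii) every carrier-binding declaration keeps its explicit binder `(Φ : PlanarSkeletonFrmFrom G)` in its own signature (r2).  Docstrings and citations are the original's.
-/

noncomputable section

open scoped Classical

namespace Summit.CriticalPhenomena.PercolationContinuityZ3.Theorems.Transplant

namespace PlanarSkeletonFrmFrom

namespace NegB

open Literature.Probability.Percolation Literature.Probability.LatticeModels SimpleGraph
open SkelConc (Consts)
open Skelφ (pgScale)
open Skelφ.StepI (DataN)
open TwoAxis.Para (modulus)
open Neg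

namespace KS

/-! ## §1 Values -/

section Values

/-- The F-pair's stride prism bound `prBF := pgScale nBF hBF (3ℓBF)` (the `pr` field of the face's B.13 frames). [this work] -/
def prBF (κ : Consts) {V : Type} [DecidableEq V] [Countable V] {G : SimpleGraph V} [G.LocallyFinite] (Φ : PlanarSkeletonFrmFrom G) (t : V) (p : unitInterval) (D : Skelφ.StepI.DataNS V) (c : ℕ) (mk : ℕ) : ℕ := pgScale (nBF κ Φ t p D c mk) (hBF κ Φ t p D c mk) (3 * ℓBF κ Φ t p D c mk)

/-- **The collar of the face bridge region** `eF := 2·RA′ + prBF` (≥ `RA′ + pr`; the extra `RA′` absorbs a landing box fattened by `j₀A ≤ RA′`). [this work] -/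
def eF (κ : Consts) {V : Type} [DecidableEq V] [Countable V] {G : SimpleGraph V} [G.LocallyFinite] (Φ : PlanarSkeletonFrmFrom G) (t : V) (p : unitInterval) (D : Skelφ.StepI.DataNS V) (c : ℕ) (mk : ℕ) : ℕ := 2 * KS0.R'0 κ Φ t p D mk + prBF κ Φ t p D c mk

/-- **`ΛF₀ := m + 3n_Lℓ_L + |v_β|·eF + |v_L|·(ℓ_L + eF)`.** [this work] -/
def ΛF₀ (κ : Consts) {V : Type} [DecidableEq V] [Countable V] {G : SimpleGraph V} [G.LocallyFinite] (Φ : PlanarSkeletonFrmFrom G) (t : V) (p : unitInterval) (D : Skelφ.StepI.DataNS V) (c : ℕ) (mk : ℕ) (g : ℕ) (f : ℕ) : ℤ := modulus (nL κ Φ t p D g f) (hL κ Φ t p D g f) (vL κ Φ t p D g f) (vβL κ Φ t p D g f) + 3 * (nL κ Φ t p D g f : ℤ) * ℓL κ Φ t p D g f +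
  |vβL κ Φ t p D g f| * eF κ Φ t p D c mk + |vL κ Φ t p D g f| * ((ℓL κ Φ t p D g f : ℤ) + eF κ Φ t p D c mk)

/-- **`ΛF₁ := 4n_Lℓ_L + (n_L + |h_L|)·eF`.** [this work] -/
def ΛF₁ (κ : Consts) {V : Type} [DecidableEq V] [Countable V] {G : SimpleGraph V} [G.LocallyFinite] (Φ : PlanarSkeletonFrmFrom G) (t : V) (p : unitInterval) (D : Skelφ.StepI.DataNS V) (c : ℕ) (mk : ℕ) (g : ℕ) (f : ℕ) : ℤ := 4 * (nL κ Φ t p D g f : ℤ) * ℓL κ Φ t p D g f + ((nL κ Φ t p D g f : ℤ) + |hL κ Φ t p D g f|) * eF κ Φ t p D c mk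

/-- **`kF₀A := ⌈c₀·|A|·ΛF₀ / D_A⌉`** (floor + 1) over `prFA`. [this work] -/
def kF₀A (κ : Consts) {V : Type} [DecidableEq V] [Countable V] {G : SimpleGraph V} [G.LocallyFinite] (Φ : PlanarSkeletonFrmFrom G) (t : V) (p : unitInterval) (D : Skelφ.StepI.DataNS V) (c : ℕ) (mk : ℕ) (g : ℕ) (f : ℕ) : ℤ := (prFA κ Φ t p D g f).c₀ * (|(prFA κ Φ t p D g f).A| * ΛF₀ κ Φ t p D c mk g f) / (prFA κ Φ t p D g f).D + 1

/-- **`kF₁A := ⌈c₁·|A|·ΛF₁ / D_A⌉`** (floor + 1) over `prFA`. [this work] -/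
def kF₁A (κ : Consts) {V : Type} [DecidableEq V] [Countable V] {G : SimpleGraph V} [G.LocallyFinite] (Φ : PlanarSkeletonFrmFrom G) (t : V) (p : unitInterval) (D : Skelφ.StepI.DataNS V) (c : ℕ) (mk : ℕ) (g : ℕ) (f : ℕ) : ℤ := (prFA κ Φ t p D g f).c₁ * (|(prFA κ Φ t p D g f).A| * ΛF₁ κ Φ t p D c mk g f) / (prFA κ Φ t p D g f).D + 1

/-- **Positivity of the (ζ″) lattice record** under the numeric long clause: `0 < A`, `1 ≤ n`, `0 < modulus`, `0 < c₀`, `0 < c₁`, `0 < D_A` (re-homed from N1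
`SkelNegBParamsReachTA` (retired under (R-22)); proof verbatim over `prFA_fields/prFA_c_pos`). [folklore] -/
theorem prFA_pos (κ : Consts) {V : Type} [DecidableEq V] [Countable V] {G : SimpleGraph V} [G.LocallyFinite] (Φ : PlanarSkeletonFrmFrom G) (t : V) (p : unitInterval)
    (D : Skelφ.StepI.DataNS V) (g f : ℕ) (hN : EqNumL κ Φ t p D g f) :
    0 < (prFA κ Φ t p D g f).A ∧ 1 ≤ (prFA κ Φ t p D g f).n ∧ 0 < modulus (prFA κ Φ t p D g f).n (prFA κ Φ t p D g f).h (prFA κ Φ t p D g f).vα (prFA κ Φ t p D g f).vβ ∧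
      0 < (prFA κ Φ t p D g f).c₀ ∧ 0 < (prFA κ Φ t p D g f).c₁ ∧ 0 < (prFA κ Φ t p D g f).D := by
  obtain ⟨hn1, hℓ1⟩ := one_le_of_eqNumL κ Φ t p D g f hN
  obtain ⟨hA, hn, hh, hvα, hvβ, -, -, hD⟩ := prFA_fields κ Φ t p D g f
  have hm : 0 < modulus (prFA κ Φ t p D g f).n (prFA κ Φ t p D g f).h (prFA κ Φ t p D g f).vα (prFA κ Φ t p D g f).vβ := by
    rw [hn, hh, hvα, hvβ]; exact Skelφ.NegPrm.modulus_vβOf_pos hn1 hℓ1 _ _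
  refine ⟨by rw [hA]; exact (Aof_pos κ).1, by rw [hn]; exact_mod_cast hn1, hm, (prFA_c_pos κ Φ t p D g f).1, (prFA_c_pos κ Φ t p D g f).2, ?_⟩
  rw [hD]; exact Skelφ.NegPrm.DofA_pos (Aof_pos κ).2 hn1 hℓ1 _ _

/-- `0 ≤ ΛF₀`, `0 ≤ ΛF₁`. [folklore] -/
theorem ΛF_nonneg (κ : Consts) {V : Type} [DecidableEq V] [Countable V] {G : SimpleGraph V} [G.LocallyFinite] (Φ : PlanarSkeletonFrmFrom G) (t : V) (p : unitInterval) (D : Skelφ.StepI.DataNS V) (c : ℕ) (mk : ℕ) (g : ℕ) (f : ℕ) (hN : EqNumL κ Φ t p D g f) : 0 ≤ ΛF₀ κ Φ t p D c mk g f ∧ 0 ≤ ΛF₁ κ Φ t p D c mk g f := by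
  obtain ⟨hn1, hℓ1⟩ := one_le_of_eqNumL κ Φ t p D g f hN
  have hm : 0 < modulus (nL κ Φ t p D g f) (hL κ Φ t p D g f) (vL κ Φ t p D g f) (vβL κ Φ t p D g f) :=
    Skelφ.NegPrm.modulus_vβOf_pos hn1 hℓ1 _ _
  unfold ΛF₀ ΛF₁
  constructor <;> positivity

/-- `1 ≤ kF₀A`, `1 ≤ kF₁A`. [folklore] -/
theorem kFA_pos (κ : Consts) {V : Type} [DecidableEq V] [Countable V] {G : SimpleGraph V} [G.LocallyFinite] (Φ : PlanarSkeletonFrmFrom G) (t : V) (p : unitInterval) (D : Skelφ.StepI.DataNS V) (c : ℕ) (mk : ℕ) (g : ℕ) (f : ℕ) (hN : EqNumL κ Φ t p D g f) : 1 ≤ kF₀A κ Φ t p D c mk g f ∧ 1 ≤ kF₁A κ Φ t p D c mk g f := by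
  obtain ⟨hΛp0, hΛp1⟩ := ΛF_nonneg κ Φ t p D c mk g f hN
  obtain ⟨hA, -, -, hc₀, hc₁, hD⟩ := prFA_pos κ Φ t p D g f hN
  have hAabs : 0 ≤ |(prFA κ Φ t p D g f).A| := abs_nonneg _
  constructor
  · unfold kF₀A
    have : 0 ≤ (prFA κ Φ t p D g f).c₀ * (|(prFA κ Φ t p D g f).A| * ΛF₀ κ Φ t p D c mk g f) / (prFA κ Φ t p D g f).D :=
      Int.ediv_nonneg (mul_nonneg hc₀.le (mul_nonneg hAabs hΛp0)) hD.le
    linarith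
  · unfold kF₁A
    have : 0 ≤ (prFA κ Φ t p D g f).c₁ * (|(prFA κ Φ t p D g f).A| * ΛF₁ κ Φ t p D c mk g f) / (prFA κ Φ t p D g f).D :=
      Int.ediv_nonneg (mul_nonneg hc₁.le (mul_nonneg hAabs hΛp1)) hD.le
    linarith

/-- **`hkF0`** (hp-8's `hkA0`-shape at the prFA projections): `c₀·(|A|·ΛF₀) ≤ kF₀A·D`. [folklore] -/
theorem hkF0_RA (κ : Consts) {V : Type} [DecidableEq V] [Countable V] {G : SimpleGraph V} [G.LocallyFinite] (Φ : PlanarSkeletonFrmFrom G) (t : V) (p : unitInterval) (D : Skelφ.StepI.DataNS V) (c : ℕ) (mk : ℕ) (g : ℕ) (f : ℕ) (hN : EqNumL κ Φ t p D g f) :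
    (prFA κ Φ t p D g f).c₀ * (|(prFA κ Φ t p D g f).A| * ΛF₀ κ Φ t p D c mk g f) ≤ kF₀A κ Φ t p D c mk g f * (prFA κ Φ t p D g f).D := by
  have hD := (prFA_pos κ Φ t p D g f hN).2.2.2.2.2
  unfold kF₀A
  rw [mul_comm (_ / _ + 1)]
  exact ceil_mul_le hD

/-- **`hkF1`**: `c₁·(|A|·ΛF₁) ≤ kF₁A·D`. [folklore] -/
theorem hkF1_RA (κ : Consts) {V : Type} [DecidableEq V] [Countable V] {G : SimpleGraph V} [G.LocallyFinite] (Φ : PlanarSkeletonFrmFrom G) (t : V) (p : unitInterval) (D : Skelφ.StepI.DataNS V) (c : ℕ) (mk : ℕ) (g : ℕ) (f : ℕ) (hN : EqNumL κ Φ t p D g f) :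
    (prFA κ Φ t p D g f).c₁ * (|(prFA κ Φ t p D g f).A| * ΛF₁ κ Φ t p D c mk g f) ≤ kF₁A κ Φ t p D c mk g f * (prFA κ Φ t p D g f).D := by
  have hD := (prFA_pos κ Φ t p D g f hN).2.2.2.2.2
  unfold kF₁A
  rw [mul_comm (_ / _ + 1)]
  exact ceil_mul_le hD

/-- **`hΛQ0/hΛQ1` at the F-values**: `m + n_L·(3ℓ_L) ≤ ΛF₀`, `n_L·(3ℓ_L) ≤ ΛF₁` (the hop prism's functional bounds are dominated). [folklore] -/
theorem hΛQ_F (κ : Consts) {V : Type} [DecidableEq V] [Countable V] {G : SimpleGraph V} [G.LocallyFinite] (Φ : PlanarSkeletonFrmFrom G) (t : V) (p : unitInterval) (D : Skelφ.StepI.DataNS V) (c : ℕ) (mk : ℕ) (g : ℕ) (f : ℕ) : modulus (nL κ Φ t p D g f) (hL κ Φ t p D g f) (vL κ Φ t p D g f) (vβL κ Φ t p D g f) + (nL κ Φ t p D g f : ℤ) * ((3 * ℓL κ Φ t p D g f : ℕ) : ℤ) ≤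
      ΛF₀ κ Φ t p D c mk g f ∧ (nL κ Φ t p D g f : ℤ) * ((3 * ℓL κ Φ t p D g f : ℕ) : ℤ) ≤ ΛF₁ κ Φ t p D c mk g f := by
  unfold ΛF₀ ΛF₁
  have h1 : 0 ≤ |vβL κ Φ t p D g f| * (eF κ Φ t p D c mk : ℤ) := by positivity
  have h2 : 0 ≤ |vL κ Φ t p D g f| * ((ℓL κ Φ t p D g f : ℤ) + eF κ Φ t p D c mk) := by positivity
  have h3 : 0 ≤ ((nL κ Φ t p D g f : ℤ) + |hL κ Φ t p D g f|) * (eF κ Φ t p D c mk : ℤ) := by positivity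
  have h4 : (0 : ℤ) ≤ (nL κ Φ t p D g f : ℤ) * ℓL κ Φ t p D g f := by positivity
  push_cast
  constructor <;> nlinarith

/-- **`hΛR` over the coordinate box** `[n_L − eF, n_L + eF] × [σh_L − eF, σh_L + ℓ_L + eF]` (`σ = ±1`): `|v_β·(σx₀) − v_L·x₁| ≤ ΛF₀`, `|n_L·x₁ − h_L·(σx₀)| ≤ ΛF₁`
— frame-free form (every face B.13 frame's region, fattened or not, lies in this box). [cite: KozmaNitzan2024, §4 p. 28] -/
theorem hΛR_F_box (κ : Consts) {V : Type} [DecidableEq V] [Countable V] {G : SimpleGraph V} [G.LocallyFinite] (Φ : PlanarSkeletonFrmFrom G) (t : V) (p : unitInterval) (D : Skelφ.StepI.DataNS V) (c : ℕ) (mk : ℕ) (g : ℕ) (f : ℕ) (hN : EqNumL κ Φ t p D g f) {σ : ℤ} (hσ : σ = 1 ∨ σ = -1) (x : Site 2)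
    (h0l : (nL κ Φ t p D g f : ℤ) - eF κ Φ t p D c mk ≤ x 0) (h0u : x 0 ≤ (nL κ Φ t p D g f : ℤ) + eF κ Φ t p D c mk)
    (h1l : σ * hL κ Φ t p D g f - eF κ Φ t p D c mk ≤ x 1) (h1u : x 1 ≤ σ * hL κ Φ t p D g f + ℓL κ Φ t p D g f + eF κ Φ t p D c mk) :
    |vβL κ Φ t p D g f * (σ * x 0) - vL κ Φ t p D g f * x 1| ≤ ΛF₀ κ Φ t p D c mk g f ∧
      |(nL κ Φ t p D g f : ℤ) * x 1 - hL κ Φ t p D g f * (σ * x 0)| ≤ ΛF₁ κ Φ t p D c mk g f := by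
  obtain ⟨hn1, hℓ1⟩ := one_le_of_eqNumL κ Φ t p D g f hN
  have hm : 0 < modulus (nL κ Φ t p D g f) (hL κ Φ t p D g f) (vL κ Φ t p D g f) (vβL κ Φ t p D g f) := Skelφ.NegPrm.modulus_vβOf_pos hn1 hℓ1 _ _
  have hσabs : |σ| = 1 := by rcases hσ with h | h <;> simp [h]
  set n : ℤ := (nL κ Φ t p D g f : ℤ)
  set hh : ℤ := hL κ Φ t p D g f
  set ℓ : ℤ := (ℓL κ Φ t p D g f : ℤ)
  set vα : ℤ := vL κ Φ t p D g f
  set vβ : ℤ := vβL κ Φ t p D g f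
  set e : ℤ := (eF κ Φ t p D c mk : ℤ)
  set m : ℤ := modulus (nL κ Φ t p D g f) hh vα vβ
  have hm' : m = n * vβ - hh * vα := rfl
  have he : (0 : ℤ) ≤ e := by positivity
  have hd0 : |x 0 - n| ≤ e := abs_le.2 ⟨by linarith, by linarith⟩
  have hs : |x 1 - σ * hh| ≤ ℓ + e := abs_le.2 ⟨by linarith [show (0:ℤ) ≤ ℓ by positivity], by linarith⟩
  constructor
  · have eq : vβ * (σ * x 0) - vα * x 1 = σ * m + σ * (vβ * (x 0 - n)) - vα * (x 1 - σ * hh) := by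
      rw [hm']; rcases hσ with h | h <;> subst h <;> ring
    rw [eq]
    calc |σ * m + σ * (vβ * (x 0 - n)) - vα * (x 1 - σ * hh)| ≤ |σ * m + σ * (vβ * (x 0 - n))| + |vα * (x 1 - σ * hh)| := abs_sub _ _
      _ ≤ |σ * m| + |σ * (vβ * (x 0 - n))| + |vα * (x 1 - σ * hh)| := by linarith [abs_add_le (σ * m) (σ * (vβ * (x 0 - n)))]
      _ = m + |vβ| * |x 0 - n| + |vα| * |x 1 - σ * hh| := by rw [abs_mul, abs_mul, abs_mul, abs_mul, hσabs, one_mul, one_mul, abs_of_pos hm]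
      _ ≤ m + |vβ| * e + |vα| * (ℓ + e) := by gcongr
      _ ≤ ΛF₀ κ Φ t p D c mk g f := by
          unfold ΛF₀
          have : (0 : ℤ) ≤ 3 * n * ℓ := by positivity
          linarith
  · have eq : n * x 1 - hh * (σ * x 0) = n * (x 1 - σ * hh) - σ * (hh * (x 0 - n)) := by
      rcases hσ with h | h <;> subst h <;> ring
    rw [eq]
    calc |n * (x 1 - σ * hh) - σ * (hh * (x 0 - n))| ≤ |n * (x 1 - σ * hh)| + |σ * (hh * (x 0 - n))| := abs_sub _ _
      _ = n * |x 1 - σ * hh| + |hh| * |x 0 - n| := by rw [abs_mul, abs_mul, abs_mul, hσabs, one_mul, Nat.abs_cast]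
      _ ≤ n * (ℓ + e) + |hh| * e := by gcongr
      _ ≤ ΛF₁ κ Φ t p D c mk g f := by
          unfold ΛF₁
          have : (0 : ℤ) ≤ n * ℓ := by positivity
          nlinarith [abs_nonneg hh]

/-- The region of the face frame `bridgeSame σ n_L h_L ℓ_L RA′ nBF hBF ℓBF` in coordinates: `[n_L − (RA′+prBF), n_L + (RA′+prBF)] × [σh_L − (RA′+prBF), σh_L + ℓ_L + (RA′+prBF)]`.
[folklore] -/
theorem mem_regionF_iff (κ : Consts) {V : Type} [DecidableEq V] [Countable V] {G : SimpleGraph V} [G.LocallyFinite] (Φ : PlanarSkeletonFrmFrom G) (t : V) (p : unitInterval) (D : Skelφ.StepI.DataNS V) (c : ℕ) (mk : ℕ) (g : ℕ) (f : ℕ) (σ : ℤ) (x : Site 2) :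
    x ∈ Finset.Icc (Skelφ.bridgeSame σ (nL κ Φ t p D g f) (hL κ Φ t p D g f) (ℓL κ Φ t p D g f) (KS0.R'0 κ Φ t p D mk) (nBF κ Φ t p D c mk) (hBF κ Φ t p D c mk) (ℓBF κ Φ t p D c mk)).regionLo
        (Skelφ.bridgeSame σ (nL κ Φ t p D g f) (hL κ Φ t p D g f) (ℓL κ Φ t p D g f) (KS0.R'0 κ Φ t p D mk) (nBF κ Φ t p D c mk) (hBF κ Φ t p D c mk) (ℓBF κ Φ t p D c mk)).regionHi ↔
      ((nL κ Φ t p D g f : ℤ) - ((KS0.R'0 κ Φ t p D mk : ℤ) + prBF κ Φ t p D c mk) ≤ x 0 ∧ x 0 ≤ (nL κ Φ t p D g f : ℤ) + ((KS0.R'0 κ Φ t p D mk : ℤ) + prBF κ Φ t p D c mk)) ∧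
        (σ * hL κ Φ t p D g f - ((KS0.R'0 κ Φ t p D mk : ℤ) + prBF κ Φ t p D c mk) ≤ x 1 ∧
          x 1 ≤ σ * hL κ Φ t p D g f + ℓL κ Φ t p D g f + ((KS0.R'0 κ Φ t p D mk : ℤ) + prBF κ Φ t p D c mk)) := by
  have hlo : (Skelφ.bridgeSame σ (nL κ Φ t p D g f) (hL κ Φ t p D g f) (ℓL κ Φ t p D g f) (KS0.R'0 κ Φ t p D mk) (nBF κ Φ t p D c mk) (hBF κ Φ t p D c mk) (ℓBF κ Φ t p D c mk)).regionLo =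
      Skelφ.pt ((nL κ Φ t p D g f : ℤ) - ((KS0.R'0 κ Φ t p D mk : ℤ) + prBF κ Φ t p D c mk)) (σ * hL κ Φ t p D g f - ((KS0.R'0 κ Φ t p D mk : ℤ) + prBF κ Φ t p D c mk)) := by
    funext i; unfold ChainPlanar.BridgePrm.regionLo Skelφ.bridgeSame prBF
    fin_cases i <;> simp [Skelφ.pt] <;> ring
  have hhi : (Skelφ.bridgeSame σ (nL κ Φ t p D g f) (hL κ Φ t p D g f) (ℓL κ Φ t p D g f) (KS0.R'0 κ Φ t p D mk) (nBF κ Φ t p D c mk) (hBF κ Φ t p D c mk) (ℓBF κ Φ t p D c mk)).regionHi =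
      Skelφ.pt ((nL κ Φ t p D g f : ℤ) + ((KS0.R'0 κ Φ t p D mk : ℤ) + prBF κ Φ t p D c mk)) (σ * hL κ Φ t p D g f + ℓL κ Φ t p D g f + ((KS0.R'0 κ Φ t p D mk : ℤ) + prBF κ Φ t p D c mk)) := by
    funext i; unfold ChainPlanar.BridgePrm.regionHi Skelφ.bridgeSame prBF
    fin_cases i <;> simp [Skelφ.pt] <;> ring
  rw [hlo, hhi, Skelφ.mem_Icc_pt_iff]

/-- **`hΛR` over the face frame's region** (`bridgeSame σ … nBF hBF ℓBF`; the TrSide/TrTop frames share the region): `|v_β·(σx₀) − v_L·x₁| ≤ ΛF₀`, `|n_L·x₁ − h_L·(σx₀)| ≤ ΛF₁`.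
[cite: KozmaNitzan2024, §4 p. 28] -/
theorem hΛR_F (κ : Consts) {V : Type} [DecidableEq V] [Countable V] {G : SimpleGraph V} [G.LocallyFinite] (Φ : PlanarSkeletonFrmFrom G) (t : V) (p : unitInterval) (D : Skelφ.StepI.DataNS V) (c : ℕ) (mk : ℕ) (g : ℕ) (f : ℕ) (hN : EqNumL κ Φ t p D g f) {σ : ℤ} (hσ : σ = 1 ∨ σ = -1) :
    ∀ x ∈ Finset.Icc (Skelφ.bridgeSame σ (nL κ Φ t p D g f) (hL κ Φ t p D g f) (ℓL κ Φ t p D g f) (KS0.R'0 κ Φ t p D mk) (nBF κ Φ t p D c mk) (hBF κ Φ t p D c mk) (ℓBF κ Φ t p D c mk)).regionLo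
        (Skelφ.bridgeSame σ (nL κ Φ t p D g f) (hL κ Φ t p D g f) (ℓL κ Φ t p D g f) (KS0.R'0 κ Φ t p D mk) (nBF κ Φ t p D c mk) (hBF κ Φ t p D c mk) (ℓBF κ Φ t p D c mk)).regionHi,
      |vβL κ Φ t p D g f * (σ * x 0) - vL κ Φ t p D g f * x 1| ≤ ΛF₀ κ Φ t p D c mk g f ∧
        |(nL κ Φ t p D g f : ℤ) * x 1 - hL κ Φ t p D g f * (σ * x 0)| ≤ ΛF₁ κ Φ t p D c mk g f := by
  intro x hx
  rw [mem_regionF_iff] at hx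
  obtain ⟨⟨h0l, h0u⟩, ⟨h1l, h1u⟩⟩ := hx
  have he : ((KS0.R'0 κ Φ t p D mk : ℤ) + prBF κ Φ t p D c mk) ≤ (eF κ Φ t p D c mk : ℤ) := by
    unfold eF; push_cast; linarith [Int.natCast_nonneg (KS0.R'0 κ Φ t p D mk)]
  exact hΛR_F_box κ Φ t p D c mk g f hN hσ x (by linarith) (by linarith) (by linarith) (by linarith)

end Values

/-! ## §2 Sizes at `g := gT mk gx` under the face floor `16·S_F ≤ M_L` -/

section AtT

/-- `prBF ≤ 3·S_F` (`S_F = nBF + ℓBF + |hBF|`). [folklore] -/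
theorem prBF_le (κ : Consts) {V : Type} [DecidableEq V] [Countable V] {G : SimpleGraph V} [G.LocallyFinite] (Φ : PlanarSkeletonFrmFrom G) (t : V) (p : unitInterval) (D : Skelφ.StepI.DataNS V) (c : ℕ) (mk : ℕ) : prBF κ Φ t p D c mk ≤ 3 * SF κ Φ t p D c mk := by
  unfold prBF SF Skelφ.pgScale; omega

/-- **`5·eF ≤ M_L`** at `g := gT mk gx`, given the face floor `16·S_F ≤ M_L` (`22000·(RA′+2) ≤ M_L` is `ML_floorsT`). [folklore] -/
theorem five_eF_le_ML (κ : Consts) {V : Type} [DecidableEq V] [Countable V] {G : SimpleGraph V} [G.LocallyFinite] (Φ : PlanarSkeletonFrmFrom G) (t : V) (p : unitInterval) (D : Skelφ.StepI.DataNS V) (c : ℕ) (mk : ℕ) (gx : Neg.FSlot) (hR0 : 22000 * (KS0.R'0 κ Φ t p D mk + 2) ≤ ML κ Φ t p D (gT mk gx κ Φ t p D)) (hSF : 16 * SF κ Φ t p D c mk ≤ ML κ Φ t p D (gT mk gx κ Φ t p D)) : 5 * eF κ Φ t p D c mk ≤ ML κ Φ t p D (gT mk gx κ Φ t p D) :=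 by
  have h1 := hR0
  have h3 := prBF_le κ Φ t p D c mk
  unfold eF; omega

/-- **`ΛF₀ ≤ 8m` and `ΛF₁ ≤ 8m`** at `g := gT mk gx` under `16·S_F ≤ M_L`. [folklore] -/
theorem ΛF_le (κ : Consts) {V : Type} [DecidableEq V] [Countable V] {G : SimpleGraph V} [G.LocallyFinite] (Φ : PlanarSkeletonFrmFrom G) (t : V) (p : unitInterval) (D : Skelφ.StepI.DataNS V) (c : ℕ) (mk : ℕ) (gx : Neg.FSlot) (f : ℕ) (hN : EqNumL κ Φ t p D (gT mk gx κ Φ t p D) f) (hκ : (hL κ Φ t p D (gT mk gx κ Φ t p D) f).natAbs ≤ 10 * nL κ Φ t p D (gT mk gx κ Φ t p D) f)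
    (hR0 : 22000 * (KS0.R'0 κ Φ t p D mk + 2) ≤ ML κ Φ t p D (gT mk gx κ Φ t p D)) (hSF : 16 * SF κ Φ t p D c mk ≤ ML κ Φ t p D (gT mk gx κ Φ t p D)) :
    ΛF₀ κ Φ t p D c mk (gT mk gx κ Φ t p D) f ≤
        8 * modulus (nL κ Φ t p D (gT mk gx κ Φ t p D) f) (hL κ Φ t p D (gT mk gx κ Φ t p D) f) (vL κ Φ t p D (gT mk gx κ Φ t p D) f) (vβL κ Φ t p D (gT mk gx κ Φ t p D) f) ∧
      ΛF₁ κ Φ t p D c mk (gT mk gx κ Φ t p D) f ≤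
        8 * modulus (nL κ Φ t p D (gT mk gx κ Φ t p D) f) (hL κ Φ t p D (gT mk gx κ Φ t p D) f) (vL κ Φ t p D (gT mk gx κ Φ t p D) f) (vβL κ Φ t p D (gT mk gx κ Φ t p D) f) := by
  obtain ⟨hn1, hℓ1⟩ := one_le_of_eqNumL κ Φ t p D _ f hN
  have hvβ := abs_vβL_le κ Φ t p D _ f hN hκ
  have hv : |vL κ Φ t p D (gT mk gx κ Φ t p D) f| ≤ nL κ Φ t p D (gT mk gx κ Φ t p D) f := hN.v_le
  have hMn := hN.n_le
  have hMℓ := hN.ℓ_le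
  have hm := (Skelφ.NegPrm.modulus_vβOf hn1 (hL κ Φ t p D (gT mk gx κ Φ t p D) f) (ℓL κ Φ t p D (gT mk gx κ Φ t p D) f) (vL κ Φ t p D (gT mk gx κ Φ t p D) f)).1
  have hκ' : |hL κ Φ t p D (gT mk gx κ Φ t p D) f| ≤ 10 * (nL κ Φ t p D (gT mk gx κ Φ t p D) f : ℤ) := by rw [← Int.natCast_natAbs]; exact_mod_cast hκ
  have h5E : ((5 * eF κ Φ t p D c mk : ℕ) : ℤ) ≤ (ML κ Φ t p D (gT mk gx κ Φ t p D) : ℤ) := by exact_mod_cast five_eF_le_ML κ Φ t p D c mk gx hR0 hSF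
  have h22 : ((22000 * (KS0.R'0 κ Φ t p D mk + 2) : ℕ) : ℤ) ≤ (ML κ Φ t p D (gT mk gx κ Φ t p D) : ℤ) := by exact_mod_cast hR0
  push_cast at h5E h22
  clear hSF hκ
  unfold ΛF₀ ΛF₁
  have e : vβL κ Φ t p D (gT mk gx κ Φ t p D) f =
      Skelφ.NegPrm.vβOf (nL κ Φ t p D (gT mk gx κ Φ t p D) f) (hL κ Φ t p D (gT mk gx κ Φ t p D) f) (ℓL κ Φ t p D (gT mk gx κ Φ t p D) f) (vL κ Φ t p D (gT mk gx κ Φ t p D) f) := rfl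
  rw [← e] at hm
  have hE0 : (0 : ℤ) ≤ (eF κ Φ t p D c mk : ℤ) := by positivity
  have hℓ9 : (9 : ℤ) ≤ (ℓL κ Φ t p D (gT mk gx κ Φ t p D) f : ℤ) := by
    have : (0 : ℤ) ≤ (KS0.R'0 κ Φ t p D mk : ℤ) := by positivity
    linarith
  generalize modulus (nL κ Φ t p D (gT mk gx κ Φ t p D) f) (hL κ Φ t p D (gT mk gx κ Φ t p D) f) (vL κ Φ t p D (gT mk gx κ Φ t p D) f) (vβL κ Φ t p D (gT mk gx κ Φ t p D) f) = m at hm ⊢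
  generalize (eF κ Φ t p D c mk : ℤ) = E at h5E hE0 ⊢
  generalize (nL κ Φ t p D (gT mk gx κ Φ t p D) f : ℤ) = n at hn1 hvβ hv hMn hm hκ' h5E ⊢
  generalize (ℓL κ Φ t p D (gT mk gx κ Φ t p D) f : ℤ) = ℓ at hℓ1 hvβ hMℓ hm hℓ9 ⊢
  generalize (ML κ Φ t p D (gT mk gx κ Φ t p D) : ℤ) = M at hMn hMℓ h5E h22 ⊢
  generalize vβL κ Φ t p D (gT mk gx κ Φ t p D) f = vβ at hvβ ⊢
  generalize vL κ Φ t p D (gT mk gx κ Φ t p D) f = vα at hv ⊢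
  generalize hL κ Φ t p D (gT mk gx κ Φ t p D) f = hh at hκ' ⊢
  have hn0 : (0 : ℤ) ≤ n := by linarith
  have p1 : |vβ| * E ≤ (ℓ + 10 * n + 1) * E := mul_le_mul_of_nonneg_right hvβ hE0
  have p2 : |vα| * (ℓ + E) ≤ n * (ℓ + E) := mul_le_mul_of_nonneg_right hv (by linarith)
  have p3 : (ℓ + 1) * (5 * E) ≤ (ℓ + 1) * (n - 1) := mul_le_mul_of_nonneg_left (by linarith) (by linarith)
  have p4 : n * (5 * E) ≤ n * (ℓ - 1) := mul_le_mul_of_nonneg_left (by linarith) hn0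
  have p5 : (n + |hh|) * E ≤ (11 * n) * E := mul_le_mul_of_nonneg_right (by linarith [abs_nonneg hh]) hE0
  have p6 : n * 8 ≤ n * (ℓ - 1) := mul_le_mul_of_nonneg_left (by linarith) hn0
  constructor
  · nlinarith
  · nlinarith

/-- **`kF₀A ≤ 8·s₀ + 1`, `kF₁A ≤ 8·s₁ + 1`** at `g := gT mk gx` under `16·S_F ≤ M_L` (`c_i·A/D_A = s_i/m`). [folklore] -/
theorem kFA_le (κ : Consts) {V : Type} [DecidableEq V] [Countable V] {G : SimpleGraph V} [G.LocallyFinite] (Φ : PlanarSkeletonFrmFrom G) (t : V) (p : unitInterval) (D : Skelφ.StepI.DataNS V) (c : ℕ) (mk : ℕ) (gx : Neg.FSlot) (f : ℕ) (hN : EqNumL κ Φ t p D (gT mk gx κ Φ t p D) f) (hκ : (hL κ Φ t p D (gT mk gx κ Φ t p D) f).natAbs ≤ 10 * nL κ Φ t p D (gT mk gx κ Φ t p D) f)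
    (hR0 : 22000 * (KS0.R'0 κ Φ t p D mk + 2) ≤ ML κ Φ t p D (gT mk gx κ Φ t p D)) (hSF : 16 * SF κ Φ t p D c mk ≤ ML κ Φ t p D (gT mk gx κ Φ t p D)) :
    kF₀A κ Φ t p D c mk (gT mk gx κ Φ t p D) f ≤ 8 * (((fcellsA κ Φ t p D (gT mk gx κ Φ t p D) f).s 0 : ℕ) : ℤ) + 1 ∧
      kF₁A κ Φ t p D c mk (gT mk gx κ Φ t p D) f ≤ 8 * (((fcellsA κ Φ t p D (gT mk gx κ Φ t p D) f).s 1 : ℕ) : ℤ) + 1 := by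
  obtain ⟨hn1, hℓ1⟩ := one_le_of_eqNumL κ Φ t p D _ f hN
  obtain ⟨hΛ0, hΛ1⟩ := ΛF_le κ Φ t p D c mk gx f hN hκ hR0 hSF
  clear hSF hκ
  have hm : 0 < modulus (nL κ Φ t p D (gT mk gx κ Φ t p D) f) (hL κ Φ t p D (gT mk gx κ Φ t p D) f) (vL κ Φ t p D (gT mk gx κ Φ t p D) f)
      (vβL κ Φ t p D (gT mk gx κ Φ t p D) f) := Skelφ.NegPrm.modulus_vβOf_pos hn1 hℓ1 _ _
  have hK : ((fcellsA κ Φ t p D (gT mk gx κ Φ t p D) f).K : ℤ) = Neg.K κ := by rw [(fcellsA_K κ Φ t p D _ f).1]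
  have hA : 0 < Aof κ := (Aof_pos κ).1
  have hA2 : (0 : ℤ) < (Aof κ) ^ 2 := pow_pos hA 2
  have key : ∀ (s : ℕ) (Λ : ℤ), Λ ≤ 8 * modulus (nL κ Φ t p D (gT mk gx κ Φ t p D) f) (hL κ Φ t p D (gT mk gx κ Φ t p D) f) (vL κ Φ t p D (gT mk gx κ Φ t p D) f)
      (vβL κ Φ t p D (gT mk gx κ Φ t p D) f) →
      20 * ((fcellsA κ Φ t p D (gT mk gx κ Φ t p D) f).K : ℤ) * ((s : ℕ) : ℤ) * (|Aof κ| * Λ) /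
          Skelφ.NegPrm.DofA (Aof κ) (nL κ Φ t p D (gT mk gx κ Φ t p D) f) (hL κ Φ t p D (gT mk gx κ Φ t p D) f) (ℓL κ Φ t p D (gT mk gx κ Φ t p D) f)
            (vL κ Φ t p D (gT mk gx κ Φ t p D) f) ≤ 8 * ((s : ℕ) : ℤ) := by
    intro s Λ hΛ
    rw [Skelφ.NegPrm.DofA_eq, hK, abs_of_pos hA]
    have e1 : 20 * (Neg.K κ : ℤ) * ((s : ℕ) : ℤ) * (Aof κ * Λ) = (Aof κ) ^ 2 * (((s : ℕ) : ℤ) * Λ) := by rw [Aof_eq_K]; ring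
    rw [e1]
    show (Aof κ) ^ 2 * (((s : ℕ) : ℤ) * Λ) / ((Aof κ) ^ 2 * modulus (nL κ Φ t p D (gT mk gx κ Φ t p D) f) (hL κ Φ t p D (gT mk gx κ Φ t p D) f)
      (vL κ Φ t p D (gT mk gx κ Φ t p D) f) (Skelφ.NegPrm.vβOf (nL κ Φ t p D (gT mk gx κ Φ t p D) f) (hL κ Φ t p D (gT mk gx κ Φ t p D) f)
        (ℓL κ Φ t p D (gT mk gx κ Φ t p D) f) (vL κ Φ t p D (gT mk gx κ Φ t p D) f))) ≤ _
    rw [Int.mul_ediv_mul_of_pos _ _ hA2,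
      show Skelφ.NegPrm.vβOf (nL κ Φ t p D (gT mk gx κ Φ t p D) f) (hL κ Φ t p D (gT mk gx κ Φ t p D) f) (ℓL κ Φ t p D (gT mk gx κ Φ t p D) f)
        (vL κ Φ t p D (gT mk gx κ Φ t p D) f) = vβL κ Φ t p D (gT mk gx κ Φ t p D) f from rfl]
    refine Int.ediv_le_of_le_mul hm ?_
    have hs : (0 : ℤ) ≤ ((s : ℕ) : ℤ) := Nat.cast_nonneg _
    have := mul_le_mul_of_nonneg_left hΛ hs
    linarith
  constructor
  · have h := key ((fcellsA κ Φ t p D (gT mk gx κ Φ t p D) f).s 0) _ hΛ0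
    show 20 * ((fcellsA κ Φ t p D (gT mk gx κ Φ t p D) f).K : ℤ) * (((fcellsA κ Φ t p D (gT mk gx κ Φ t p D) f).s 0 : ℕ) : ℤ) *
        (|Aof κ| * ΛF₀ κ Φ t p D c mk (gT mk gx κ Φ t p D) f) /
          Skelφ.NegPrm.DofA (Aof κ) (nL κ Φ t p D (gT mk gx κ Φ t p D) f) (hL κ Φ t p D (gT mk gx κ Φ t p D) f) (ℓL κ Φ t p D (gT mk gx κ Φ t p D) f)
            (vL κ Φ t p D (gT mk gx κ Φ t p D) f) + 1 ≤ _
    linarith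
  · have h := key ((fcellsA κ Φ t p D (gT mk gx κ Φ t p D) f).s 1) _ hΛ1
    show 20 * ((fcellsA κ Φ t p D (gT mk gx κ Φ t p D) f).K : ℤ) * (((fcellsA κ Φ t p D (gT mk gx κ Φ t p D) f).s 1 : ℕ) : ℤ) *
        (|Aof κ| * ΛF₁ κ Φ t p D c mk (gT mk gx κ Φ t p D) f) /
          Skelφ.NegPrm.DofA (Aof κ) (nL κ Φ t p D (gT mk gx κ Φ t p D) f) (hL κ Φ t p D (gT mk gx κ Φ t p D) f) (ℓL κ Φ t p D (gT mk gx κ Φ t p D) f)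
            (vL κ Φ t p D (gT mk gx κ Φ t p D) f) + 1 ≤ _
    linarith

/-- **The face footprint floors** at `g := gT mk gx` under `16·S_F ≤ M_L`: `kF₀A ≤ 5r₀ − 2`, `kF₁A ≤ 5r₁ − 2`, `kF₀A ≤ 25r₀ − 1`, `kF₁A ≤ 25r₁ − 1`, `−5r_i + 1 ≤ −kF_iA`
(`kF_iA ≤ 8s_i + 1`, `r_i = K·s_i`, `K ≥ 40`). [folklore] -/
theorem hfF_RA (κ : Consts) {V : Type} [DecidableEq V] [Countable V] {G : SimpleGraph V} [G.LocallyFinite] (Φ : PlanarSkeletonFrmFrom G) (t : V) (p : unitInterval) (D : Skelφ.StepI.DataNS V) (c : ℕ) (mk : ℕ) (gx : Neg.FSlot) (f : ℕ) (hN : EqNumL κ Φ t p D (gT mk gx κ Φ t p D) f) (hκ : (hL κ Φ t p D (gT mk gx κ Φ t p D) f).natAbs ≤ 10 * nL κ Φ t p D (gT mk gx κ Φ t p D) f)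
    (hR0 : 22000 * (KS0.R'0 κ Φ t p D mk + 2) ≤ ML κ Φ t p D (gT mk gx κ Φ t p D)) (hSF : 16 * SF κ Φ t p D c mk ≤ ML κ Φ t p D (gT mk gx κ Φ t p D)) :
    (kF₀A κ Φ t p D c mk (gT mk gx κ Φ t p D) f ≤ 5 * ((fcellsA κ Φ t p D (gT mk gx κ Φ t p D) f).r 0 : ℤ) - 2 ∧
        kF₁A κ Φ t p D c mk (gT mk gx κ Φ t p D) f ≤ 5 * ((fcellsA κ Φ t p D (gT mk gx κ Φ t p D) f).r 1 : ℤ) - 2) ∧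
      (kF₀A κ Φ t p D c mk (gT mk gx κ Φ t p D) f ≤ 25 * ((fcellsA κ Φ t p D (gT mk gx κ Φ t p D) f).r 0 : ℤ) - 1 ∧
        kF₁A κ Φ t p D c mk (gT mk gx κ Φ t p D) f ≤ 25 * ((fcellsA κ Φ t p D (gT mk gx κ Φ t p D) f).r 1 : ℤ) - 1) ∧
      ((-(5 * ((fcellsA κ Φ t p D (gT mk gx κ Φ t p D) f).r 0 : ℤ)) + 1 ≤ -kF₀A κ Φ t p D c mk (gT mk gx κ Φ t p D) f) ∧
        (-(5 * ((fcellsA κ Φ t p D (gT mk gx κ Φ t p D) f).r 1 : ℤ)) + 1 ≤ -kF₁A κ Φ t p D c mk (gT mk gx κ Φ t p D) f)) := by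
  obtain ⟨h0, h1⟩ := kFA_le κ Φ t p D c mk gx f hN hκ hR0 hSF
  obtain ⟨hk0, hk1⟩ := kFA_pos κ Φ t p D c mk (gT mk gx κ Φ t p D) f hN
  clear hSF hκ
  have hr := (fcellsA_K κ Φ t p D (gT mk gx κ Φ t p D) f).2.2
  have hr0 : ((fcellsA κ Φ t p D (gT mk gx κ Φ t p D) f).r 0 : ℤ) = (Neg.K κ : ℤ) * (((fcellsA κ Φ t p D (gT mk gx κ Φ t p D) f).s 0 : ℕ) : ℤ) := by
    rw [hr 0]; push_cast; ring
  have hr1 : ((fcellsA κ Φ t p D (gT mk gx κ Φ t p D) f).r 1 : ℤ) = (Neg.K κ : ℤ) * (((fcellsA κ Φ t p D (gT mk gx κ Φ t p D) f).s 1 : ℕ) : ℤ) := by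
    rw [hr 1]; push_cast; ring
  have hK : (40 : ℤ) ≤ Neg.K κ := by exact_mod_cast (Neg.forty_le_K κ).1
  have hs0 : (1 : ℤ) ≤ (((fcellsA κ Φ t p D (gT mk gx κ Φ t p D) f).s 0 : ℕ) : ℤ) := by exact_mod_cast (fcellsA κ Φ t p D (gT mk gx κ Φ t p D) f).hs 0
  have hs1 : (1 : ℤ) ≤ (((fcellsA κ Φ t p D (gT mk gx κ Φ t p D) f).s 1 : ℕ) : ℤ) := by exact_mod_cast (fcellsA κ Φ t p D (gT mk gx κ Φ t p D) f).hs 1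
  have hKs0 : 40 * (((fcellsA κ Φ t p D (gT mk gx κ Φ t p D) f).s 0 : ℕ) : ℤ) ≤ (Neg.K κ : ℤ) * (((fcellsA κ Φ t p D (gT mk gx κ Φ t p D) f).s 0 : ℕ) : ℤ) :=
    mul_le_mul_of_nonneg_right hK (by linarith)
  have hKs1 : 40 * (((fcellsA κ Φ t p D (gT mk gx κ Φ t p D) f).s 1 : ℕ) : ℤ) ≤ (Neg.K κ : ℤ) * (((fcellsA κ Φ t p D (gT mk gx κ Φ t p D) f).s 1 : ℕ) : ℤ) :=
    mul_le_mul_of_nonneg_right hK (by linarith)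
  rw [hr0, hr1]
  refine ⟨⟨by linarith, by linarith⟩, ⟨by linarith, by linarith⟩, ⟨by linarith, by linarith⟩⟩

end AtT

end KS

end NegB

end PlanarSkeletonFrmFrom

end Summit.CriticalPhenomena.PercolationContinuityZ3.Theorems.Transplant

end
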